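import Literature.AlgebraicGeometry.Frobenioids.PadicFrobenioidPerfection
import Literature.AlgebraicGeometry.Frobenioids.ModelFrobenioidMap
import HarnessLib

/-!
# Frobenioids II, Example 1.1 (ii): the perfection datum `(ord(𝒪^⊳)^pf, B)` is FUNCTORIAL in MULTIPLICATIVE valuative
# isomorphisms of the base field functor — a morphism of model data from a natural family `τ_A : K_A^× ⥲ K'_A^×`

S. Mochizuki, *The geometry of Frobenioids II*, Kyushu J. Math. **62** (2008) 401–460, §1, Example 1.1 (i)–(ii), pp. 7–8: the
monoids `Φ₀ : Spec K ↦ ord(𝒪_K^⊳)^rlf`, `B₀ : Spec K ↦ K^×`, «a natural homomorphism of monoids `B₀ → Φ₀^gp` (i.e., by considering the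
natural surjection `K^× ↠ ord(K^×)`)», and — for a monoprime subfunctor in monoids `Φ ⊆ Φ₀|_D` — the datum `B → Φ^gp` with
`B = B₀|_D ×_{Φ₀^gp|_D} Φ^gp` of a `p`-adic Frobenioid [cite: MochizukiFrdII2008, Ex 1.1 (ii) p.8].  (The last display is OUR PARAPHRASE
at monoid type `Λ = ℤ`, NOT a quotation: print's display in Ex 1.1 (ii) carries the monoid-type superscript `Λ` on `B₀` and `Φ₀` —
`B^Λ₀|_D`, `(Φ^Λ₀)^gp|_D` — and this file, like abc-iut-L1's `PadicFrobenioidPerfection`, works throughout at `Λ = ℤ`, i.e. with `B₀(K) = K^×`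
and `Φ₀(K)^gp = ord(K^×) ⊗ ℝ`, the case [IUTchI] Ex 3.3 (i) instantiates.)  *The geometry of Frobenioids I*, Kyushu J. Math. **62** (2008),
Prop. 5.3 p. 103 (morphisms of model data induce functors of model Frobenioids), Cor. 5.4 p. 104 [cite: MochizukiFrdI2008, Prop. 5.3 p.103].

## What this file builds (abc-iut cell; the L1-level brick «PERF-MUL-TRANSPORT» of abc-iut-w4-d047's row «LIFTSALL-ALL@GOOD» —
## input of the non-Γ-inner half of [IUTchI] Cor 5.3 (ii)'s surjectivity at a good place; generic, no IUT vocabulary)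

Everything in the datum `Datum.perf F` (abc-iut-L1-t4, `PadicFrobenioidPerfection`: `Φ(A) = ord(𝒪_{K_A}^⊳)^pf ⊆ ord(𝒪_{K_A}^⊳) ⊗ ℝ_{≥0}`,
`B(A) = K_A^× ×_{Φ₀(A)^gp} Φ(A)^gp`) only reads the MULTIPLICATIVE monoid `K_A^×`, its submonoid `𝒪^⊳`, and the valuation class — NOT the
addition of `K_A`.  Hence a family of MULTIPLICATIVE homomorphisms `τ_A : (F₁ A).K^× → (F₂ A).K^×` which (a) carries integral elements to integral
elements (`v(x) ≤ 1 → v(τ_A x) ≤ 1`) and (b) is natural for the pull-back maps of `B₀` (`τ_{A'} ∘ (F₁ f)^* = (F₂ f)^* ∘ τ_A`) induces a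
morphism of model data `(Φ₁, B₁, Div) → (Φ₂, B₂, Div)` between the perfection data of `F₁` and `F₂` over the SAME base `D` — with
BIJECTIVE components as soon as `τ` has an integral two-sided inverse — although `τ` is in general NOT a morphism of the base category
`D₀` of valued fields (not additive).  This is
exactly what the anabelian transport `σ_n` of [AbsTopIII] Prop 3.2 (iv) supplies at a good place of [IUTchI] (abc-iut-w4-d047
`GoodLocalFrobenioidTransporterSigma`: multiplicative, equivariant, unit- and uniformiser-preserving, never additive for a non-Γ-inner
transporter).
* §1 `PadicFrd.unitsIntMap τ hτ : 𝒪_L^⊳ → 𝒪_K^⊳`, `ordIntMapOfUnits` (`= associatesMap`), `divUnits_unitsHom`, `divZeroHom_unitsHom` — the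
  multiplicative analogues of abc-iut-L1's `intNonzeroMapOfHom`/`ordIntMapOfHom`/`divUnits_map` (those take RING homomorphisms);
* §2 `PadicFrd.perfMulTransport F₁ F₂ … τ hτ hnat : ModelFrobenioid.DataHom (Datum.perf F₁ …).divB (Datum.perf F₂ …).divB` — components
  `η_A = (ord τ_A) ⊗ ℝ_{≥0}` restricted to the perfections (`Realification.map_mem_perf`), `β_A (x, γ) = (τ_A x, η_A^gp γ)`; `comm` is `rfl`;
* §3 two-sided inverse from an integral inverse family `τ'` (`perfMulTransportη_leftInverse`, `perfMulTransportβ_leftInverse`) ⇒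
  `perfMulTransportη_bijective`, `perfMulTransportβ_bijective` — the inputs of abc-iut-w5-d137's `DataHomOver.functor_isEquivalence`
  ([FrdI] Cor 5.4).
Binders: `τ`, `hτ`, `hnat` (displayed); no instance · no notation · no `Prop` fact.  Classical plumbing over landed L1 files; nothing here
concerns [IUTchIII] Cor. 3.12; no side is taken on any disputed claim.
-/

noncomputable section

namespace Literature.AlgebraicGeometry.Frobenioids

open CategoryTheory Opposite Function
open scoped ValuativeRel

namespace PadicFrd

universe u v

/-! ### §1. Multiplicative integral maps of unit groups and the induced maps on `𝒪^⊳`, `ord(𝒪^⊳)`, `ord(𝒪^⊳) ⊗ ℝ_{≥0}` -/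

section UnitsHom

variable {K L : Type u} [Field K] [ValuativeRel K] [Field L] [ValuativeRel L]

/-- **`𝒪_L^⊳ → 𝒪_K^⊳` induced by a MULTIPLICATIVE map of unit groups `τ : L^× → K^×` carrying integral elements to integral
elements** (the multiplicative analogue of abc-iut-L1's `intNonzeroMapOfHom` for valuative ring homomorphisms).
[cite: MochizukiFrdII2008, Ex 1.1 (i) p.7] -/
def unitsIntMap (τ : Lˣ →* Kˣ) (hτ : ∀ x : Lˣ, ValuativeRel.valuation L (x : L) ≤ 1 → ValuativeRel.valuation K (τ x : K) ≤ 1) :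
    intNonzero L →* intNonzero K where
  toFun x := ⟨(τ (intNonzeroToUnits L x) : K), hτ _ x.2.1, (τ _).ne_zero⟩
  map_one' := Subtype.ext (by
    change ((τ (intNonzeroToUnits L 1) : Kˣ) : K) = 1
    rw [map_one, map_one, Units.val_one])
  map_mul' x y := Subtype.ext (by
    change ((τ (intNonzeroToUnits L (x * y)) : Kˣ) : K) = (τ (intNonzeroToUnits L x) : K) * (τ (intNonzeroToUnits L y) : K)
    rw [map_mul, map_mul, Units.val_mul])

/-- The value of `unitsIntMap`. [cite: MochizukiFrdII2008, Ex 1.1 (i) p.7] -/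
@[simp] theorem coe_unitsIntMap (τ : Lˣ →* Kˣ)
    (hτ : ∀ x : Lˣ, ValuativeRel.valuation L (x : L) ≤ 1 → ValuativeRel.valuation K (τ x : K) ≤ 1) (x : intNonzero L) :
    ((unitsIntMap τ hτ x : intNonzero K) : K) = (τ (intNonzeroToUnits L x) : K) := rfl

/-- `unitsIntMap` followed by `𝒪_K^⊳ → K^×` is `τ` after `𝒪_L^⊳ → L^×`. [cite: MochizukiFrdII2008, Ex 1.1 (i) p.7] -/
theorem intNonzeroToUnits_unitsIntMap (τ : Lˣ →* Kˣ)
    (hτ : ∀ x : Lˣ, ValuativeRel.valuation L (x : L) ≤ 1 → ValuativeRel.valuation K (τ x : K) ≤ 1) (x : intNonzero L) :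
    intNonzeroToUnits K (unitsIntMap τ hτ x) = τ (intNonzeroToUnits L x) :=
  Units.ext rfl

/-- **`ord(𝒪_L^⊳) → ord(𝒪_K^⊳)` induced by `τ`** (`associatesMap`). [cite: MochizukiFrdII2008, Ex 1.1 (i) p.7] -/
def ordIntMapOfUnits (τ : Lˣ →* Kˣ)
    (hτ : ∀ x : Lˣ, ValuativeRel.valuation L (x : L) ≤ 1 → ValuativeRel.valuation K (τ x : K) ≤ 1) : OrdInt L →* OrdInt K :=
  associatesMap (unitsIntMap τ hτ)

/-- `ordIntMapOfUnits` on representatives. [cite: MochizukiFrdII2008, Ex 1.1 (i) p.7] -/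
@[simp] theorem ordIntMapOfUnits_mk (τ : Lˣ →* Kˣ)
    (hτ : ∀ x : Lˣ, ValuativeRel.valuation L (x : L) ≤ 1 → ValuativeRel.valuation K (τ x : K) ≤ 1) (x : intNonzero L) :
    ordIntMapOfUnits τ hτ (Associates.mk x) = Associates.mk (unitsIntMap τ hτ x) :=
  associatesMap_mk _ _

/-- **Naturality of the divisor map `K^× → ord(𝒪^⊳)^gp` along `τ`**: `div_K (τ x) = (ord τ)^gp (div_L x)` — `L^×` is covered by
`𝒪_L^⊳` and its inverses, where both sides are the class map (abc-iut-L1 `divUnits_intNonzeroToUnits`).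
[cite: MochizukiFrdII2008, Ex 1.1 (i) p.7] -/
theorem divUnits_unitsHom (τ : Lˣ →* Kˣ)
    (hτ : ∀ x : Lˣ, ValuativeRel.valuation L (x : L) ≤ 1 → ValuativeRel.valuation K (τ x : K) ≤ 1) (x : Lˣ) :
    divUnits K (τ x) = MonGp.map (ordIntMapOfUnits τ hτ) (divUnits L x) := by
  suffices key : ∀ y : intNonzero L,
      divUnits K (τ (intNonzeroToUnits L y)) = MonGp.map (ordIntMapOfUnits τ hτ) (divUnits L (intNonzeroToUnits L y)) by
    by_cases hx : ValuativeRel.valuation L (x : L) ≤ 1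
    · have e : intNonzeroToUnits L ⟨(x : L), hx, x.ne_zero⟩ = x := Units.ext rfl
      have h := key ⟨x, hx, x.ne_zero⟩
      rwa [e] at h
    · have hx' : ValuativeRel.valuation L ((x⁻¹ : Lˣ) : L) ≤ 1 := by
        rw [Units.val_inv_eq_inv_val, map_inv₀]
        exact inv_le_one_of_one_le₀ (le_of_not_ge hx)
      have h := key ⟨((x⁻¹ : Lˣ) : L), hx', (x⁻¹).ne_zero⟩
      have e : intNonzeroToUnits L ⟨((x⁻¹ : Lˣ) : L), hx', (x⁻¹).ne_zero⟩ = x⁻¹ := Units.ext rfl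
      rw [e, map_inv, map_inv, map_inv, map_inv, inv_inj] at h
      exact h
  intro y
  rw [← intNonzeroToUnits_unitsIntMap τ hτ y, divUnits_intNonzeroToUnits, divUnits_intNonzeroToUnits, MonGp.map_of,
    ordIntMapOfUnits_mk]

/-- `(ord τ ⊗ ℝ_{≥0}) ∘ (− ⊗ 1) = (− ⊗ 1) ∘ ord τ` (abc-iut-L1 `Realification.map_of`). [cite: MochizukiFrdI2008, §0 p.10] -/
theorem realificationMap_comp_of (τ : Lˣ →* Kˣ)
    (hτ : ∀ x : Lˣ, ValuativeRel.valuation L (x : L) ≤ 1 → ValuativeRel.valuation K (τ x : K) ≤ 1) :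
    (Realification.map (ordIntMapOfUnits τ hτ)).comp (Realification.of (OrdInt L)) =
      (Realification.of (OrdInt K)).comp (ordIntMapOfUnits τ hτ) :=
  MonoidHom.ext fun a => Realification.map_of _ a

/-- **Naturality of `Div₀ : K^× → (ord(𝒪^⊳) ⊗ ℝ_{≥0})^gp` along `τ`**: `Div₀ (τ x) = ((ord τ) ⊗ ℝ_{≥0})^gp (Div₀ x)`.
[cite: MochizukiFrdII2008, Ex 1.1 (i) p.7] -/
theorem divZeroHom_unitsHom (τ : Lˣ →* Kˣ)
    (hτ : ∀ x : Lˣ, ValuativeRel.valuation L (x : L) ≤ 1 → ValuativeRel.valuation K (τ x : K) ≤ 1) (x : Lˣ) :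
    divZeroHom K (τ x) = MonGp.map (Realification.map (ordIntMapOfUnits τ hτ)) (divZeroHom L x) := by
  rw [divZeroHom, divZeroHom, MonoidHom.comp_apply, MonoidHom.comp_apply, divUnits_unitsHom τ hτ, ← MonoidHom.comp_apply,
    ← MonGp.map_comp, ← realificationMap_comp_of τ hτ, MonGp.map_comp, MonoidHom.comp_apply]

/-- `unitsIntMap` of a composite in which the middle leg returns: if `τ' (τ u) = u` for all `u` then
`unitsIntMap τ' ∘ unitsIntMap τ = id` on `𝒪_L^⊳`. [cite: MochizukiFrdII2008, Ex 1.1 (i) p.7] -/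
theorem unitsIntMap_unitsIntMap_of_leftInverse {E : Type u} [Field E] [ValuativeRel E] (τ : Lˣ →* Kˣ)
    (hτ : ∀ x : Lˣ, ValuativeRel.valuation L (x : L) ≤ 1 → ValuativeRel.valuation K (τ x : K) ≤ 1) (τ' : Kˣ →* Eˣ)
    (hτ' : ∀ x : Kˣ, ValuativeRel.valuation K (x : K) ≤ 1 → ValuativeRel.valuation E (τ' x : E) ≤ 1)
    (x : intNonzero L) :
    ((unitsIntMap τ' hτ' (unitsIntMap τ hτ x) : intNonzero E) : E) = (τ' (τ (intNonzeroToUnits L x)) : E) := by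
  rw [coe_unitsIntMap, intNonzeroToUnits_unitsIntMap]

end UnitsHom

/-! ### §2. The morphism of perfection data induced by a natural multiplicative valuative family `τ` -/

section Transport

variable {D : Type u} [Category.{v} D] {p : ℕ} [Fact p.Prime] (F₁ F₂ : D ⥤ PadicFld.{u} p)
  (hloc₁ : ∀ A : D, (F₁.obj A).IsPadicLocal) (hloc₂ : ∀ A : D, (F₂.obj A).IsPadicLocal)
  (hc : IsConnected D) (he : IsTotallyEpimorphic D)
  (τ : ∀ A : D, (F₁.obj A).Kˣ →* (F₂.obj A).Kˣ)
  (hτ : ∀ (A : D) (x : (F₁.obj A).Kˣ),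
    ValuativeRel.valuation (F₁.obj A).K (x : (F₁.obj A).K) ≤ 1 → ValuativeRel.valuation (F₂.obj A).K (τ A x : (F₂.obj A).K) ≤ 1)
  (hnat : ∀ {A A' : D} (f : A' ⟶ A) (x : (F₁.obj A).Kˣ),
    τ A' (Units.map ((F₁.map f).alg : (F₁.obj A).K →* (F₁.obj A').K) x) =
      Units.map ((F₂.map f).alg : (F₂.obj A).K →* (F₂.obj A').K) (τ A x))

/-- **The component `η_A : ord(𝒪^⊳_{K_A})^pf → ord(𝒪^⊳_{K'_A})^pf`** — `(ord τ_A) ⊗ ℝ_{≥0}` restricted to the perfections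
(`Realification.map_mem_perf`). [cite: MochizukiFrdII2008, Ex 1.1 (ii) p.8] -/
def perfMulTransportη (A : D) :
    ↥(Realification.perf (OrdInt (F₁.obj A).K)) →* ↥(Realification.perf (OrdInt (F₂.obj A).K)) :=
  ((Realification.map (ordIntMapOfUnits (τ A) (hτ A))).restrict _).codRestrict _ fun x =>
    Realification.map_mem_perf _ x.2

omit [Fact p.Prime] in
/-- The value of `η_A`. [cite: MochizukiFrdII2008, Ex 1.1 (ii) p.8] -/
@[simp] theorem coe_perfMulTransportη (A : D) (x : ↥(Realification.perf (OrdInt (F₁.obj A).K))) :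
    ((perfMulTransportη F₁ F₂ τ hτ A x : ↥(Realification.perf (OrdInt (F₂.obj A).K))) : Realification (OrdInt (F₂.obj A).K)) =
      Realification.map (ordIntMapOfUnits (τ A) (hτ A)) x.1 := rfl

omit [Fact p.Prime] in
include hnat in
/-- **`τ` intertwines the pull-back maps of `𝒪^⊳`** along `f : A' → A`: `τ_{A'} ∘ (F₁ f)^* = (F₂ f)^* ∘ τ_A` on `𝒪^⊳_{K_A}`.
[cite: MochizukiFrdII2008, Ex 1.1 (ii) p.8] -/
theorem unitsIntMap_natural {A A' : D} (f : A' ⟶ A) (y : intNonzero (F₁.obj A).K) :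
    unitsIntMap (τ A') (hτ A') (intNonzeroMapOfHom (F₁.map f).alg (F₁.map f).isValHom y) =
      intNonzeroMapOfHom (F₂.map f).alg (F₂.map f).isValHom (unitsIntMap (τ A) (hτ A) y) := by
  apply Subtype.ext
  rw [coe_unitsIntMap, coe_intNonzeroMapOfHom, coe_unitsIntMap]
  have e : intNonzeroToUnits (F₁.obj A').K (intNonzeroMapOfHom (F₁.map f).alg (F₁.map f).isValHom y) =
      Units.map ((F₁.map f).alg : (F₁.obj A).K →* (F₁.obj A').K) (intNonzeroToUnits (F₁.obj A).K y) := Units.ext rfl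
  rw [e, hnat f]
  rfl

omit [Fact p.Prime] in
include hnat in
/-- … hence on `ord(𝒪^⊳) ⊗ ℝ_{≥0}`: `(ord τ_{A'} ⊗ ℝ) ∘ Φ₀(f) = Φ₀(f) ∘ (ord τ_A ⊗ ℝ)` (abc-iut-L1 `realificationMap_comp`).
[cite: MochizukiFrdII2008, Ex 1.1 (ii) p.8] -/
theorem realificationMap_phi0Map {A A' : D} (f : A' ⟶ A) (x : Realification (OrdInt (F₁.obj A).K)) :
    Realification.map (ordIntMapOfUnits (τ A') (hτ A')) (phi0Map F₁ f.op x) =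
      phi0Map F₂ f.op (Realification.map (ordIntMapOfUnits (τ A) (hτ A)) x) := by
  change Realification.map (ordIntMapOfUnits (τ A') (hτ A'))
      (Realification.map (ordIntMapOfHom (F₁.map f).alg (F₁.map f).isValHom) x) =
    Realification.map (ordIntMapOfHom (F₂.map f).alg (F₂.map f).isValHom) (Realification.map (ordIntMapOfUnits (τ A) (hτ A)) x)
  rw [← MonoidHom.comp_apply, ← realificationMap_comp, ← MonoidHom.comp_apply, ← realificationMap_comp]
  congr 2
  ext a
  obtain ⟨y, rfl⟩ := Associates.mk_surjective a
  rw [MonoidHom.comp_apply, MonoidHom.comp_apply, ordIntMapOfHom_mk, ordIntMapOfUnits_mk, ordIntMapOfUnits_mk, ordIntMapOfHom_mk,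
    unitsIntMap_natural F₁ F₂ τ hτ hnat]


include hnat in
/-- … hence on `Φ^gp = (ord(𝒪^⊳)^pf)^gp`: `η_{A'}^gp ∘ Φ₁(f)^gp = Φ₂(f)^gp ∘ η_A^gp` (over abc-iut-L1-t4's `SubDatum.ΦMap`, the underlying
homomorphism of `Φ(f)`). [cite: MochizukiFrdII2008, Ex 1.1 (ii) p.8] -/
theorem map_perfMulTransportη_natural {A A' : Dᵒᵖ} (g : A ⟶ A')
    (γ : Algebra.GrothendieckGroup ↥(Realification.perf (OrdInt (F₁.obj A.unop).K))) :
    MonGp.map (perfMulTransportη F₁ F₂ τ hτ A'.unop) (MonGp.map ((perfSubDatum F₁ hloc₁).ΦMap g) γ) =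
      MonGp.map ((perfSubDatum F₂ hloc₂).ΦMap g) (MonGp.map (perfMulTransportη F₁ F₂ τ hτ A.unop) γ) := by
  have key : (MonGp.map (perfMulTransportη F₁ F₂ τ hτ A'.unop)).comp (MonGp.map ((perfSubDatum F₁ hloc₁).ΦMap g)) =
      (MonGp.map ((perfSubDatum F₂ hloc₂).ΦMap g)).comp (MonGp.map (perfMulTransportη F₁ F₂ τ hτ A.unop)) := by
    rw [← MonGp.map_comp, ← MonGp.map_comp]
    congr 1
    refine MonoidHom.ext fun x => Subtype.ext ?_
    change Realification.map (ordIntMapOfUnits (τ A'.unop) (hτ A'.unop)) (phi0Map F₁ g x.1) =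
      phi0Map F₂ g (Realification.map (ordIntMapOfUnits (τ A.unop) (hτ A.unop)) x.1)
    exact realificationMap_phi0Map F₁ F₂ τ hτ hnat g.unop x.1
  exact DFunLike.congr_fun key γ

omit [Fact p.Prime] in
/-- The pair `(τ_A x, η_A^gp γ)` lies in `B₂(A)` whenever `(x, γ) ∈ B₁(A)`: naturality of `Div₀` along `τ` and `ι₂ ∘ η = (ord τ ⊗ ℝ) ∘ ι₁`.
[cite: MochizukiFrdII2008, Ex 1.1 (ii) p.8] -/
theorem perfMulTransportβ_mem (A : Dᵒᵖ) (x : (F₁.obj A.unop).Kˣ)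
    (γ : Algebra.GrothendieckGroup ↥(Realification.perf (OrdInt (F₁.obj A.unop).K)))
    (hq : divZeroHom (F₁.obj A.unop).K x = MonGp.map (Submonoid.subtype (Realification.perf (OrdInt (F₁.obj A.unop).K))) γ) :
    divZeroHom (F₂.obj A.unop).K (τ A.unop x) =
      MonGp.map (Submonoid.subtype (Realification.perf (OrdInt (F₂.obj A.unop).K)))
        (MonGp.map (perfMulTransportη F₁ F₂ τ hτ A.unop) γ) := by
  rw [divZeroHom_unitsHom (τ A.unop) (hτ A.unop), hq, ← MonoidHom.comp_apply, ← MonGp.map_comp, ← MonoidHom.comp_apply,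
    ← MonGp.map_comp]
  exact congrArg (fun φ => MonGp.map φ γ) (MonoidHom.ext fun _ => rfl)

/-- **The component `β_A : B₁(A) → B₂(A)`** on the fibre products `B = K^× ×_{Φ₀^gp} Φ^gp`: `(x, γ) ↦ (τ_A x, η_A^gp γ)` — it lands in
`B₂(A)` by the naturality of `Div₀` along `τ` (`divZeroHom_unitsHom`) and `ι₂ ∘ η = (ord τ ⊗ ℝ) ∘ ι₁` (`perfMulTransportβ_mem`).
[cite: MochizukiFrdII2008, Ex 1.1 (ii) p.8] -/
def perfMulTransportβ (A : Dᵒᵖ) :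
    ↥((perfSubDatum F₁ hloc₁).BSub A) →* ↥((perfSubDatum F₂ hloc₂).BSub A) where
  toFun q := ⟨(τ A.unop q.1.1, MonGp.map (perfMulTransportη F₁ F₂ τ hτ A.unop) q.1.2),
    perfMulTransportβ_mem F₁ F₂ τ hτ A q.1.1 q.1.2 (((perfSubDatum F₁ hloc₁).mem_BSub_iff A q.1).mp q.2)⟩
  map_one' := Subtype.ext (Prod.ext (map_one (τ A.unop)) (map_one (MonGp.map (perfMulTransportη F₁ F₂ τ hτ A.unop))))
  map_mul' q r := Subtype.ext (Prod.ext (map_mul (τ A.unop) q.1.1 r.1.1)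
    (map_mul (MonGp.map (perfMulTransportη F₁ F₂ τ hτ A.unop)) q.1.2 r.1.2))

/-- The value of `β_A`: first component `τ_A x`. [cite: MochizukiFrdII2008, Ex 1.1 (ii) p.8] -/
@[simp] theorem perfMulTransportβ_fst (A : Dᵒᵖ) (q : ↥((perfSubDatum F₁ hloc₁).BSub A)) :
    ((perfMulTransportβ F₁ F₂ hloc₁ hloc₂ τ hτ A q : ↥((perfSubDatum F₂ hloc₂).BSub A)).1).1 = τ A.unop q.1.1 := rfl

/-- The value of `β_A`: second component `η_A^gp γ`. [cite: MochizukiFrdII2008, Ex 1.1 (ii) p.8] -/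
@[simp] theorem perfMulTransportβ_snd (A : Dᵒᵖ) (q : ↥((perfSubDatum F₁ hloc₁).BSub A)) :
    ((perfMulTransportβ F₁ F₂ hloc₁ hloc₂ τ hτ A q : ↥((perfSubDatum F₂ hloc₂).BSub A)).1).2 =
      MonGp.map (perfMulTransportη F₁ F₂ τ hτ A.unop) q.1.2 := rfl

/-- **THE MORPHISM OF PERFECTION DATA `(Φ₁, B₁, Div) → (Φ₂, B₂, Div)` induced by `τ`** ([FrdI] Prop 5.3: it induces a functor of
the `p`-adic Frobenioids; [FrdII] Ex 1.1 (ii)): `η = (ord τ) ⊗ ℝ_{≥0}` on the perfections, `β = (τ, η^gp)` on the fibre products,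
compatibility with `Div_B` (the second projection) definitional. [cite: MochizukiFrdII2008, Ex 1.1 (ii) p.8] -/
def perfMulTransport :
    ModelFrobenioid.DataHom (Datum.perf F₁ hloc₁ hc he).divB (Datum.perf F₂ hloc₂ hc he).divB where
  η :=
    { app := fun A => CommMonCat.ofHom (perfMulTransportη F₁ F₂ τ hτ A.unop)
      naturality := fun {A A'} g => by
        apply CommMonCat.hom_ext
        refine MonoidHom.ext fun x => Subtype.ext ?_
        change Realification.map (ordIntMapOfUnits (τ A'.unop) (hτ A'.unop)) (phi0Map F₁ g x.1) =
          phi0Map F₂ g (Realification.map (ordIntMapOfUnits (τ A.unop) (hτ A.unop)) x.1)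
        exact realificationMap_phi0Map F₁ F₂ τ hτ hnat g.unop x.1 }
  β :=
    { app := fun A => CommMonCat.ofHom (perfMulTransportβ F₁ F₂ hloc₁ hloc₂ τ hτ A)
      naturality := fun {A A'} g => by
        apply CommMonCat.hom_ext
        refine MonoidHom.ext fun q => Subtype.ext (Prod.ext ?_ ?_)
        · change τ A'.unop (Units.map ((F₁.map g.unop).alg : (F₁.obj A.unop).K →* (F₁.obj A'.unop).K) q.1.1) =
            Units.map ((F₂.map g.unop).alg : (F₂.obj A.unop).K →* (F₂.obj A'.unop).K) (τ A.unop q.1.1)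
          exact hnat g.unop q.1.1
        · change MonGp.map (perfMulTransportη F₁ F₂ τ hτ A'.unop) (MonGp.map ((perfSubDatum F₁ hloc₁).ΦMap g) q.1.2) =
            MonGp.map ((perfSubDatum F₂ hloc₂).ΦMap g) (MonGp.map (perfMulTransportη F₁ F₂ τ hτ A.unop) q.1.2)
          exact map_perfMulTransportη_natural F₁ F₂ hloc₁ hloc₂ τ hτ hnat g q.1.2 }
  comm A u := rfl

/-- The `η`-component of `perfMulTransport` is `perfMulTransportη`. [cite: MochizukiFrdII2008, Ex 1.1 (ii) p.8] -/
theorem perfMulTransport_η_app (A : Dᵒᵖ) :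
    ((perfMulTransport F₁ F₂ hloc₁ hloc₂ hc he τ hτ hnat).η.app A).hom = perfMulTransportη F₁ F₂ τ hτ A.unop := rfl

/-- The `β`-component of `perfMulTransport` is `perfMulTransportβ`. [cite: MochizukiFrdII2008, Ex 1.1 (ii) p.8] -/
theorem perfMulTransport_β_app (A : Dᵒᵖ) :
    ((perfMulTransport F₁ F₂ hloc₁ hloc₂ hc he τ hτ hnat).β.app A).hom = perfMulTransportβ F₁ F₂ hloc₁ hloc₂ τ hτ A := rfl

end Transport

/-! ### §3. Two-sided inverse from `τ⁻¹`, hence bijective components ([FrdI] Cor 5.4's hypothesis) -/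

section Inverse

variable {D : Type u} [Category.{v} D] {p : ℕ} [Fact p.Prime] (F₁ F₂ : D ⥤ PadicFld.{u} p)
  (hloc₁ : ∀ A : D, (F₁.obj A).IsPadicLocal) (hloc₂ : ∀ A : D, (F₂.obj A).IsPadicLocal)
  (τ : ∀ A : D, (F₁.obj A).Kˣ →* (F₂.obj A).Kˣ) (τ' : ∀ A : D, (F₂.obj A).Kˣ →* (F₁.obj A).Kˣ)
  (hτ : ∀ (A : D) (x : (F₁.obj A).Kˣ),
    ValuativeRel.valuation (F₁.obj A).K (x : (F₁.obj A).K) ≤ 1 → ValuativeRel.valuation (F₂.obj A).K (τ A x : (F₂.obj A).K) ≤ 1)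
  (hτ' : ∀ (A : D) (x : (F₂.obj A).Kˣ),
    ValuativeRel.valuation (F₂.obj A).K (x : (F₂.obj A).K) ≤ 1 → ValuativeRel.valuation (F₁.obj A).K (τ' A x : (F₁.obj A).K) ≤ 1)
  (hinv : ∀ (A : D) (x : (F₁.obj A).Kˣ), τ' A (τ A x) = x)

omit [Fact p.Prime] in
include hinv in
/-- `ord τ' ∘ ord τ = id` on `ord(𝒪^⊳)`. [cite: MochizukiFrdII2008, Ex 1.1 (i) p.7] -/
theorem ordIntMapOfUnits_leftInverse (A : D) (a : OrdInt (F₁.obj A).K) :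
    ordIntMapOfUnits (τ' A) (hτ' A) (ordIntMapOfUnits (τ A) (hτ A) a) = a := by
  obtain ⟨y, rfl⟩ := Associates.mk_surjective a
  rw [ordIntMapOfUnits_mk, ordIntMapOfUnits_mk]
  congr 1
  apply Subtype.ext
  rw [unitsIntMap_unitsIntMap_of_leftInverse, hinv]
  rfl

omit [Fact p.Prime] in
include hinv in
/-- `η' ∘ η = id` on the perfections. [cite: MochizukiFrdII2008, Ex 1.1 (ii) p.8] -/
theorem perfMulTransportη_leftInverse (A : D) (x : ↥(Realification.perf (OrdInt (F₁.obj A).K))) :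
    perfMulTransportη F₂ F₁ τ' hτ' A (perfMulTransportη F₁ F₂ τ hτ A x) = x := by
  apply Subtype.ext
  rw [coe_perfMulTransportη, coe_perfMulTransportη, ← MonoidHom.comp_apply, ← realificationMap_comp]
  have h : (ordIntMapOfUnits (τ' A) (hτ' A)).comp (ordIntMapOfUnits (τ A) (hτ A)) = MonoidHom.id _ :=
    MonoidHom.ext fun a => ordIntMapOfUnits_leftInverse F₁ F₂ τ τ' hτ hτ' hinv A a
  rw [h, realificationMap_id, MonoidHom.id_apply]

include hinv in
/-- `β' ∘ β = id` on the fibre products. [cite: MochizukiFrdII2008, Ex 1.1 (ii) p.8] -/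
theorem perfMulTransportβ_leftInverse (A : Dᵒᵖ) (q : ↥((perfSubDatum F₁ hloc₁).BSub A)) :
    perfMulTransportβ F₂ F₁ hloc₂ hloc₁ τ' hτ' A (perfMulTransportβ F₁ F₂ hloc₁ hloc₂ τ hτ A q) = q := by
  refine Subtype.ext (Prod.ext ?_ ?_)
  · rw [perfMulTransportβ_fst, perfMulTransportβ_fst, hinv]
  · rw [perfMulTransportβ_snd, perfMulTransportβ_snd, ← MonoidHom.comp_apply, ← MonGp.map_comp]
    have h : (perfMulTransportη F₂ F₁ τ' hτ' A.unop).comp (perfMulTransportη F₁ F₂ τ hτ A.unop) = MonoidHom.id _ :=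
      MonoidHom.ext fun x => perfMulTransportη_leftInverse F₁ F₂ τ τ' hτ hτ' hinv A.unop x
    rw [h, MonGp.map_id, MonoidHom.id_apply]

variable (hinv' : ∀ (A : D) (y : (F₂.obj A).Kˣ), τ A (τ' A y) = y)

omit [Fact p.Prime] in
include τ' hτ' hinv hinv' in
/-- **`η_A` is BIJECTIVE** when `τ` has a two-sided integral inverse `τ'`. [cite: MochizukiFrdI2008, Cor. 5.4 p.104] -/
theorem perfMulTransportη_bijective (A : D) : Bijective (perfMulTransportη F₁ F₂ τ hτ A) :=
  Function.bijective_iff_has_inverse.mpr ⟨perfMulTransportη F₂ F₁ τ' hτ' A,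
    fun x => perfMulTransportη_leftInverse F₁ F₂ τ τ' hτ hτ' hinv A x,
    fun y => perfMulTransportη_leftInverse F₂ F₁ τ' τ hτ' hτ hinv' A y⟩

include τ' hτ' hinv hinv' in
/-- **`β_A` is BIJECTIVE** when `τ` has a two-sided integral inverse `τ'`. [cite: MochizukiFrdI2008, Cor. 5.4 p.104] -/
theorem perfMulTransportβ_bijective (A : Dᵒᵖ) : Bijective (perfMulTransportβ F₁ F₂ hloc₁ hloc₂ τ hτ A) :=
  Function.bijective_iff_has_inverse.mpr ⟨perfMulTransportβ F₂ F₁ hloc₂ hloc₁ τ' hτ' A,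
    fun q => perfMulTransportβ_leftInverse F₁ F₂ hloc₁ hloc₂ τ τ' hτ hτ' hinv A q,
    fun q => perfMulTransportβ_leftInverse F₂ F₁ hloc₂ hloc₁ τ' τ hτ' hτ hinv' A q⟩

end Inverse

end PadicFrd

end Literature.AlgebraicGeometry.Frobenioids

end
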